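import Summits.Ventures.GridStability.Models.InverterDroopGFMSMIBDeg4Roa
import Summits.Ventures.GridStability.Bench.GFMSMIBDeg4AQoriaV4physBallS8
import Summits.Ventures.GridStability.Models.SMIBInstanceGFM
import HarnessLib

/-!
# G3.a+ «GFM-SMIB-QoriaV4» deg-4 — rider «GFM-SMIB-DEG4 BALL+» (sub-box cover K = 8, supersession `_S8`) (model half): an ellipsoid of CONVERTER STATES around the
# synchronous equilibrium inside the degree-4 certified region, with the ROA sentence from it (parametric SMIB reading and the two
# typed instances of record, NO data hypothesis left)

Venture GRIDFUSION, cell `gridfusion`; seat gridfusion-lyap-2 (generator g4; filed by g5 as the SUPERSESSION «BALL+» of `Bench/GFMSMIBDeg4AQoriaV4physRoaBallModel.lean` p549417 under NEW names: `Bench/GFMSMIBDeg4AQoriaV4physRoaBallS8Model.lean`, declarations suffixed `_S8`; files of record untouched); LOW rider (pattern of «#62′ WSCC9-DEG4-BALL» p544490). Sibling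
of `GFMSMIBDeg4AQoriaV4physBallS8.lean` (recast half: `σ² + κ² + ω²/100 ≤ (9/8)²` ∩ {h = 0} ⊆ {V₄ ≤ 21/4}, sub-box cover, one `decide`
per box on `Lyapunov/PolyRecastBox`), of lyap-1's `GFMSMIBDeg4AQoriaV4physRoa.lean` (`…_smib_roa`: parametric SMIB record `p` with
the A1 data relations, level `21/4`, window `|u₀| < π`) and of model-3's hypothesis-free converter reading of the SAME deg-4 region
`Models/InverterDroopGFMSMIBDeg4Roa.lean` (`InverterDroop.gfmSmibQoriaV4.deg4_A_roa` / `deg4_A_freq_tendsto`: droop grid-forming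
converter `InverterDroop.gfmSmibQoriaV4` transported along model-3's exact bridge `ReducedParams.toGridSMIB`, kernel facts
`gfmSmibQoriaV4.rel_a / rel_b / rel_d / power_balance`), which it imports and CITES (nothing of the transport is redone); the
model-1 twin reading uses `SMIB.gfmQoriaV4Phys_relations` / `gfmQoriaV4Phys_isEquilibrium` (`Models/SMIBInstanceGFM.lean`) exactly
as the deg-2 model half `Bench/GFMSMIBDeg2AQoriaV4physRoaModel.lean` (lyap-1 p475563). New facts: `sin²u + (1 − cos u)² ≤ u²` and
the packaging; the window hypothesis `|u₀| < π` is discharged by the ellipsoid (`u₀² ≤ s² ≤ 2 < π²`).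

STATEMENTS. `deg4_A_QoriaV4phys_smib_roa_ball_S8`: for ANY SMIB record `p` and equilibrium angle `δs` with the A1 data relations of the
instance (`a = 233605208200/1873666673`, `b = 29431488000/1873666673`, `d = 33`, `P_e(δs) = P_m`) and every solution `x = (δ, ω)` of
`p` on `[0, ∞)` with `(δ(0) − δs)² + ω(0)²/100 ≤ (9/8)²`: `V₄ ≤ 21/4` along the recast state and `|δ t − δs| < π` for all `t ≥ 0`
(no pole slip), and `(δ t, ω t) → (δs, 0)`. `deg4_A_QoriaV4phys_gfmQoriaV4Phys_roa_ball_S8`: the same read on `SMIB.gfmQoriaV4Phys`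
(`δs = SMIB.deltaQV4`), hypothesis-free. `deg4_A_QoriaV4phys_droop_roa_ball_S8`: on the droop converter model
`InverterDroop.gfmSmibQoriaV4` (all-time solutions `(δ, ω)`, `Ω = ω_b′(ω − ω_e)` in rad/s): `(δ(0) − δ^s)² + Ω(0)²/100 ≤ (9/8)²` ⇒
no pole slip, `δ t → δ^s` and `ω t → ω_e`. RENDERINGS of `s = 9/8` (VALIDATED column only — decimal readings of the exact literal):
converter angle displaced by ≤ 64.5° at nominal frequency, or a frequency deviation `|Ω| ≤ 11.25 rad/s` (= 3.58 % of `ω_b′ =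
35500/113 rad/s`) at the operating angle, or any state on the ellipsoid between.

THREE COLUMNS. CERTIFIED (kernel): the inclusion of the ellipsoid in the certified piece (recast half) + this packaging. MODELLED:
as the parent row G3.a+ (M′ = reduced-order droop / VSM grid-forming converter against an infinite bus ≡ classical SMIB in physical
time; MODEL-VALIDITY MV-6D+MV-P+MV-Ω(ω_b′ = 35500/113): inner loops, filter / line / dc-side dynamics, current limits, voltage
dynamics ABSENT; whether a realistic converter tuning realises these numbers is model-4's data question, params.json
a0e6894da9d00899). VALIDATED: only the renderings of `s`. No sentence here says a converter or a grid is stable; the ellipsoid is a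
set of initial states OF THE MODEL M′ inside a CERTIFICATE's sublevel piece (a crude coefficient-majorant inner description of it),
carried to the synchronous equilibrium of M′ without pole slip — never «the ROA of the system».
-/

namespace Summit.Ventures.GridStability.Bench.GFMSMIB

open Set Filter Metric Topology Real
open Summit.Ventures.GridStability.Lyapunov Summit.Ventures.GridStability.Models
open Literature.Computation.Certificates Literature.Computation.Certificates.SOS

noncomputable section

/-- `sin²u + (1 − cos u)² = 2 − 2cos u ≤ u²` (from `1 − u²/2 ≤ cos u`). [folklore] -/
private theorem sin_sq_add_one_sub_cos_sq_le' (u : ℝ) : sin u ^ 2 + (1 - cos u) ^ 2 ≤ u ^ 2 := by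
  nlinarith [sin_sq_add_cos_sq u, Real.one_sub_sq_div_two_le_cos (x := u)]

/-- **The machine-coordinate ellipsoid lies in the certified piece**: `(δ − δs)² + ω²/100 ≤ (9/8)²` ⇒
`V₄(sin u, 1 − cos u, ω) ≤ 21/4` (`u = δ − δs`). [folklore] -/
theorem deg4_A_QoriaV4phys_V_embed_le_level_of_ball_S8 (δs : ℝ) (y : ℝ × ℝ)
    (hball : (y.1 - δs) ^ 2 + y.2 ^ 2 / 100 ≤ (9 / 8 : ℝ) ^ 2) :
    deg4_A_QoriaV4phys_V (sin (y.1 - δs)) (1 - cos (y.1 - δs)) y.2 ≤ deg4_A_QoriaV4phys_level := by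
  have hM := deg4_A_QoriaV4phys_embed_mem_M δs y
  have hh : deg4_A_QoriaV4phys_h (sin (y.1 - δs)) (1 - cos (y.1 - δs)) y.2 = 0 := by
    simpa [deg4_A_QoriaV4phys_M] using hM
  have hZ := sin_sq_add_one_sub_cos_sq_le' (y.1 - δs)
  show deg4_A_QoriaV4phys_V (sin (y.1 - δs)) (1 - cos (y.1 - δs)) y.2 ≤ 21 / 4
  exact deg4_A_QoriaV4phys_V_le_level_of_ball_S8 _ _ _ hh (by linarith)

/-- The ellipsoid discharges the window hypothesis: `(δ − δs)² + ω²/100 ≤ (9/8)² ≤ 2` ⇒ `|δ − δs| ≤ √2 < π`. [folklore] -/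
theorem deg4_A_QoriaV4phys_abs_lt_pi_of_ball_S8 (δs : ℝ) (y : ℝ × ℝ)
    (hball : (y.1 - δs) ^ 2 + y.2 ^ 2 / 100 ≤ (9 / 8 : ℝ) ^ 2) : |y.1 - δs| < π := by
  have h1 := abs_le_of_sq_le_sq' (show (y.1 - δs) ^ 2 ≤ (2 : ℝ) ^ 2 by nlinarith [sq_nonneg y.2]) (by norm_num)
  exact abs_lt.2 ⟨by linarith [Real.pi_gt_three, h1.1], by linarith [Real.pi_gt_three, h1.2]⟩

/-- **«GFM-SMIB-DEG4 BALL» — parametric SMIB reading.** For ANY SMIB record `p` and equilibrium angle `δs` satisfying the A1 data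
relations of the certified instance and every solution `x = (δ, ω)` on `[0, ∞)` with `(δ(0) − δs)² + ω(0)²/100 ≤ (9/8)²`: for all
`t ≥ 0`, `V₄ ≤ 21/4` along the recast state and `|δ t − δs| < π` (no pole slip), and `(δ t, ω t) → (δs, 0)`. MODELLED column as in
the module docstring. [folklore] -/
theorem deg4_A_QoriaV4phys_smib_roa_ball_S8 (p : SMIB) {δs : ℝ} (hM : p.M ≠ 0)
    (ha : ((233605208200/1873666673 : ℚ) : ℝ) = p.PM * cos (δs - p.γ) / p.M)
    (hb : ((29431488000/1873666673 : ℚ) : ℝ) = p.PM * sin (δs - p.γ) / p.M)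
    (hd : ((33 : ℚ) : ℝ) = p.D / p.M) (hP : p.IsEquilibrium δs)
    {x : ℝ → ℝ × ℝ} (hx : p.IsSolutionOn x (Ici 0))
    (hball : ((x 0).1 - δs) ^ 2 + (x 0).2 ^ 2 / 100 ≤ (9 / 8 : ℝ) ^ 2) :
    (∀ t, 0 ≤ t → deg4_A_QoriaV4phys_V (sin ((x t).1 - δs)) (1 - cos ((x t).1 - δs)) (x t).2 ≤ deg4_A_QoriaV4phys_level ∧
      |(x t).1 - δs| < π) ∧ Tendsto x atTop (𝓝 (δs, 0)) := by
  have hγ0 : (0 : ℝ) < deg4_A_QoriaV4phys_level := by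
    unfold deg4_A_QoriaV4phys_level; norm_num
  exact deg4_A_QoriaV4phys_smib_roa p hM ha hb hd hP hγ0 le_rfl hx (deg4_A_QoriaV4phys_V_embed_le_level_of_ball_S8 δs (x 0) hball)
    (deg4_A_QoriaV4phys_abs_lt_pi_of_ball_S8 δs (x 0) hball)

/-- **«GFM-SMIB-DEG4 BALL» on model-1's physical-time SMIB twin `SMIB.gfmQoriaV4Phys`** (`δs = SMIB.deltaQV4`; the data relations
are model-1's kernel facts, NO data hypothesis left): every solution on `[0, ∞)` with `(δ(0) − δ*)² + ω(0)²/100 ≤ (9/8)²` keeps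
`V₄ ≤ 21/4`, never pole-slips, and tends to `(δ*, 0)`. MODELLED: MV-6D+MV-P+MV-Ω(ω_b′ = 35500/113). [folklore] -/
theorem deg4_A_QoriaV4phys_gfmQoriaV4Phys_roa_ball_S8 {x : ℝ → ℝ × ℝ} (hx : SMIB.gfmQoriaV4Phys.IsSolutionOn x (Ici 0))
    (hball : ((x 0).1 - SMIB.deltaQV4) ^ 2 + (x 0).2 ^ 2 / 100 ≤ (9 / 8 : ℝ) ^ 2) :
    (∀ t, 0 ≤ t → deg4_A_QoriaV4phys_V (sin ((x t).1 - SMIB.deltaQV4)) (1 - cos ((x t).1 - SMIB.deltaQV4)) (x t).2 ≤ deg4_A_QoriaV4phys_level ∧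
      |(x t).1 - SMIB.deltaQV4| < π) ∧ Tendsto x atTop (𝓝 (SMIB.deltaQV4, 0)) := by
  obtain ⟨ha, hb, hd⟩ := SMIB.gfmQoriaV4Phys_relations
  have hM : SMIB.gfmQoriaV4Phys.M ≠ 0 := by simp only [SMIB.gfmQoriaV4Phys]; norm_num
  exact deg4_A_QoriaV4phys_smib_roa_ball_S8 SMIB.gfmQoriaV4Phys hM ha hb hd SMIB.gfmQoriaV4Phys_isEquilibrium hx hball

/-- **«GFM-SMIB-DEG4 BALL» on the droop grid-forming converter model of record `InverterDroop.gfmSmibQoriaV4`** (`ω_b′ = 35500/113`,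
`ω_c = 33`, `k_i = 3550/3729`, `p*′ = 8290560/16581121`, `P_max = 4`, `ω_set = ω_e = 1`; equilibrium angle
`δ^s = InverterDroop.gfmSmibQoriaV4_δs`): model-3's hypothesis-free deg-4 reading `InverterDroop.gfmSmibQoriaV4.deg4_A_roa` at the
full level, its two initial hypotheses discharged by the ellipsoid. For every solution `(δ, ω)` of the model (all times) with
`(δ(0) − δ^s)² + Ω(0)²/100 ≤ (9/8)²`, `Ω = ω_b′(ω − ω_e)` [rad/s]: for all `t ≥ 0`, `V₄ ≤ 21/4` along the recast state and
`|δ t − δ^s| < π` (no pole slip of the converter angle), and `(δ t, Ω t) → (δ^s, 0)`. MODELLED: MV-6D+MV-P+MV-Ω(ω_b′ = 35500/113).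
No sentence here says a converter or a grid is stable. [folklore] -/
theorem deg4_A_QoriaV4phys_droop_roa_ball_S8 {δ ω : ℝ → ℝ} (h : InverterDroop.gfmSmibQoriaV4.IsSolution δ ω)
    (hball : (δ 0 - InverterDroop.gfmSmibQoriaV4_δs) ^ 2 +
      (InverterDroop.gfmSmibQoriaV4.ωb * (ω 0 - InverterDroop.gfmSmibQoriaV4.ωe)) ^ 2 / 100 ≤ (9 / 8 : ℝ) ^ 2) :
    (∀ t, 0 ≤ t →
        deg4_A_QoriaV4phys_V (sin (δ t - InverterDroop.gfmSmibQoriaV4_δs)) (1 - cos (δ t - InverterDroop.gfmSmibQoriaV4_δs))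
            (InverterDroop.gfmSmibQoriaV4.ωb * (ω t - InverterDroop.gfmSmibQoriaV4.ωe)) ≤ deg4_A_QoriaV4phys_level ∧
          |δ t - InverterDroop.gfmSmibQoriaV4_δs| < π) ∧
      Tendsto (fun t => (δ t, InverterDroop.gfmSmibQoriaV4.ωb * (ω t - InverterDroop.gfmSmibQoriaV4.ωe)))
        atTop (𝓝 (InverterDroop.gfmSmibQoriaV4_δs, 0)) := by
  have hγ0 : (0 : ℝ) < deg4_A_QoriaV4phys_level := by
    unfold deg4_A_QoriaV4phys_level; norm_num
  exact InverterDroop.gfmSmibQoriaV4.deg4_A_roa hγ0 le_rfl h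
    (deg4_A_QoriaV4phys_V_embed_le_level_of_ball_S8 InverterDroop.gfmSmibQoriaV4_δs
      (δ 0, InverterDroop.gfmSmibQoriaV4.ωb * (ω 0 - InverterDroop.gfmSmibQoriaV4.ωe)) hball)
    (deg4_A_QoriaV4phys_abs_lt_pi_of_ball_S8 InverterDroop.gfmSmibQoriaV4_δs
      (δ 0, InverterDroop.gfmSmibQoriaV4.ωb * (ω 0 - InverterDroop.gfmSmibQoriaV4.ωe)) hball)

/-- Corollary in the converter's own per-unit frequency (model-3's `deg4_A_freq_tendsto` under the ball hypothesis): `δ t → δ^s`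
and `ω t → ω_e`. MODELLED: MV-6D+MV-P+MV-Ω. [folklore] -/
theorem deg4_A_QoriaV4phys_droop_tendsto_of_ball_S8 {δ ω : ℝ → ℝ} (h : InverterDroop.gfmSmibQoriaV4.IsSolution δ ω)
    (hball : (δ 0 - InverterDroop.gfmSmibQoriaV4_δs) ^ 2 +
      (InverterDroop.gfmSmibQoriaV4.ωb * (ω 0 - InverterDroop.gfmSmibQoriaV4.ωe)) ^ 2 / 100 ≤ (9 / 8 : ℝ) ^ 2) :
    Tendsto δ atTop (𝓝 InverterDroop.gfmSmibQoriaV4_δs) ∧ Tendsto ω atTop (𝓝 InverterDroop.gfmSmibQoriaV4.ωe) := by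
  have hγ0 : (0 : ℝ) < deg4_A_QoriaV4phys_level := by
    unfold deg4_A_QoriaV4phys_level; norm_num
  exact InverterDroop.gfmSmibQoriaV4.deg4_A_freq_tendsto hγ0 le_rfl h
    (deg4_A_QoriaV4phys_V_embed_le_level_of_ball_S8 InverterDroop.gfmSmibQoriaV4_δs
      (δ 0, InverterDroop.gfmSmibQoriaV4.ωb * (ω 0 - InverterDroop.gfmSmibQoriaV4.ωe)) hball)
    (deg4_A_QoriaV4phys_abs_lt_pi_of_ball_S8 InverterDroop.gfmSmibQoriaV4_δs
      (δ 0, InverterDroop.gfmSmibQoriaV4.ωb * (ω 0 - InverterDroop.gfmSmibQoriaV4.ωe)) hball)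

end

end Summit.Ventures.GridStability.Bench.GFMSMIB
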